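import Mathlib
import Summits.Ventures.PercRepro2.HCovSwap
import Summits.Ventures.PercRepro2.PatternAD
import Summits.Ventures.PercRepro2.RootLeafOEvents
import Summits.Ventures.PercRepro2.RootLeafOAtoms1
import Summits.Ventures.PercRepro2.RootLeafOAtoms2

/-!
# (HCOV) when a ROOT is a leaf at `o` — the (G4-o) theorem (blind cell PercRepro2, p4 g2; S3 GAP (G4), the second
root-leaf class: proofs/subclaims/S3-CLASSES.md §S3.10 (G4-o))

Let the root `a₁` be a LEAF attached to `o` by the single edge `f` of weight `q = p f`, with
`a₂, a₃, b ≠ a₁` (`G − a₁` arbitrary).  In the `(o, a₂)`-world of `G − a₁` write `Q = {o ↮ a₂}`,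
`Z = P(Q)`, `L = C(o)`, `H = C(a₂)`, `N` = neither, `d = P(Q, a₃ ∈ N)`, `x = P(Q, a₃ ∈ L)`,
`y = P(Q, a₃ ∈ H)`, `Y_L = P(Q, b ∈ L)`, `M′ = P(Q, b ∈ L, a₃ ∈ H)`, `A = {o ↔ a₂} ∪ {o ↔ a₃}`
(an INCREASING event that is not a box event of the world), `E = Q ∩ {o ↮ a₃}` (decreasing),
`e₀ = P(o ↔ a₂, a₃ ↮ a₂)`, `S = P(Ω)`.

* With `f` closed the root is isolated (the (ONE-ROOT) zero world); with `f` open `a₁ ≡ o` (the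
  coincidence zero world).  Every mass of `Gc` is the `q`-mixture of its two world values
  (`RootLeafOEvents`), every world mass is a sum of the thirteen cells of the pattern of
  `(o, a₂, a₃, b)` (`RootLeafOAtoms1/2`), and `Gc` is a cubic in `q` vanishing at `0` and `1`.
* **`Gc_root_leaf_o`** (exact identity, a polynomial identity in the cells after the rewrites):

  `S·Gc = q(1−q)²·S·U + q²(1−q)·2·C`,

  `U = 2(x + d)[S·M′ + P(E)P(bH) − S·P(E, bH)] + 2e₀[S·Y_L + S·P(oH, bH) − P(oH)P(bH)]`,
  `C = S·Y_L·(d·P(oH) − xy) + S·(x + d)·Z·M′ + (dZ + xy + x² + dx)·[S·P(A, bH) − P(A)P(bH)]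
       + (d·P(oH) − xy)·[S·P(oH, bH) − P(oH)P(bH)]`
  (`U` is the first `q`-Bernstein coefficient of the cubic, `2C` the second).
* **`HCov_root_leaf_o`**: with `S = 1`, the brackets are Harris slacks of increasing events
  (`{b ↔ a₂}` against `{o ↔ a₂}` and against `A`), the mixed Harris slack of the decreasing `E`
  against `{b ↔ a₂}`, and `d·P(oH) − xy ≥ 0` is the four-functions inequality `(D_D)`
  (`PatternAD.prob_mul_prob_le_three` with `u = a₃`, `v = o`, `w = a₂`, then
  `P(o ↔ a₂, a₃ ↔ a₂) ≤ P(o ↔ a₂)`); hence (HCOV) holds at every labelled instance whose root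
  `a₁` is a leaf at `o`, for every weight of the leaf edge; by the root symmetry `Gc_swap` the
  same holds for `a₂` a leaf at `o` (`HCov_root_leaf_o'`).  Own exact checks
  (mining/p4/g2/cert_o.py, formal_o.py): the certificate on 300 / 300 random instances `n ≤ 7`
  on three palettes, and the identity as a formal polynomial identity in the 15 pattern atoms.
-/

namespace Summit.Ventures.PercRepro2

open UnionCluster CovForm PendantRoot

namespace RootLeafO

variable {V : Type*} {E : Type*} [Fintype E] [DecidableEq E] {R : Type*} [Field R]
  [LinearOrder R] [IsStrictOrderedRing R]

/-! ## The identity and the theorem -/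

section Main

variable [Fintype V] [DecidableEq V] (p : E → R) (ends : E → Sym2 V)

omit [LinearOrder R] [IsStrictOrderedRing R] in
/-- **The root-leaf identity at `o`** (p4 g2, S3 (G4-o)): with the root `a₁` a leaf at `o` through
`f` (`q = p f`), in the `(o, a₂)`-world of `G − a₁` (`Q = {o ↮ a₂}`, `Z = P(Q)`, `d = P(Q, a₃ ∈ N)`,
`x = P(Q, a₃ ∈ L)`, `y = P(Q, a₃ ∈ H)`, `Y_L = P(Q, b ∈ L)`, `M′ = P(Q, b ∈ L, a₃ ∈ H)`,
`A = {o ↔ a₂} ∪ {o ↔ a₃}`, `E = Q ∩ {o ↮ a₃}`, `e₀ = P(o ↔ a₂, a₃ ↮ a₂)`, `S = P(Ω)`):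

`S·Gc = q(1−q)²·S·U + q²(1−q)·2·C` with
`U = 2(x + d)[S·M′ + P(E)P(bH) − S·P(E, bH)] + 2e₀[S·Y_L + S·P(oH, bH) − P(oH)P(bH)]` and
`C = S·Y_L·(d·P(oH) − xy) + S·(x + d)·Z·M′ + (dZ + xy + x² + dx)·[S·P(A, bH) − P(A)P(bH)]
     + (d·P(oH) − xy)·[S·P(oH, bH) − P(oH)P(bH)]`,

a polynomial identity in the thirteen cell masses after the two-world decomposition. -/
theorem Gc_root_leaf_o {f : E} {a₁ o : V} (hf : ends f = s(a₁, o))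
    (hleaf : ∀ e, a₁ ∈ ends e → e = f) (h1o : a₁ ≠ o) {a₂ a₃ b : V} (h12 : a₁ ≠ a₂)
    (h13 : a₁ ≠ a₃) (hb : b ≠ a₁) :
    prob p Set.univ * Gc p ends o a₁ a₂ a₃ b =
      p f * (1 - p f) ^ 2 * (prob p Set.univ *
        (2 * (prob p (TEvent ends a₂ o a₃) + prob p (PDEvent ends o a₂ a₃)) *
            (prob p Set.univ * prob p (TEvent ends o a₂ a₃ ∩ connEvent ends o b) +
              prob p (avoidAll ends a₂ {o} ∩ (connEvent ends o a₃)ᶜ) * prob p (connEvent ends a₂ b) -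
              prob p Set.univ *
                prob p (avoidAll ends a₂ {o} ∩ (connEvent ends o a₃)ᶜ ∩ connEvent ends a₂ b)) +
          2 * prob p (connEvent ends o a₂ ∩ (connEvent ends a₂ a₃)ᶜ) *
            (prob p Set.univ * prob p (avoidAll ends a₂ {o} ∩ connEvent ends o b) +
              prob p Set.univ * prob p (connEvent ends o a₂ ∩ connEvent ends a₂ b) -
              prob p (connEvent ends o a₂) * prob p (connEvent ends a₂ b)))) +
      p f ^ 2 * (1 - p f) * (2 *
        (prob p Set.univ * prob p (avoidAll ends a₂ {o} ∩ connEvent ends o b) *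
            (prob p (PDEvent ends o a₂ a₃) * prob p (connEvent ends o a₂) -
              prob p (TEvent ends a₂ o a₃) * prob p (TEvent ends o a₂ a₃)) +
          prob p Set.univ * (prob p (TEvent ends a₂ o a₃) + prob p (PDEvent ends o a₂ a₃)) *
            prob p (avoidAll ends a₂ {o}) * prob p (TEvent ends o a₂ a₃ ∩ connEvent ends o b) +
          (prob p (PDEvent ends o a₂ a₃) * prob p (avoidAll ends a₂ {o}) +
              prob p (TEvent ends a₂ o a₃) * prob p (TEvent ends o a₂ a₃) +
              prob p (TEvent ends a₂ o a₃) * prob p (TEvent ends a₂ o a₃) +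
              prob p (PDEvent ends o a₂ a₃) * prob p (TEvent ends a₂ o a₃)) *
            (prob p Set.univ *
                prob p ((connEvent ends o a₂ ∪ connEvent ends o a₃) ∩ connEvent ends a₂ b) -
              prob p (connEvent ends o a₂ ∪ connEvent ends o a₃) * prob p (connEvent ends a₂ b)) +
          (prob p (PDEvent ends o a₂ a₃) * prob p (connEvent ends o a₂) -
              prob p (TEvent ends a₂ o a₃) * prob p (TEvent ends o a₂ a₃)) *
            (prob p Set.univ * prob p (connEvent ends o a₂ ∩ connEvent ends a₂ b) -
              prob p (connEvent ends o a₂) * prob p (connEvent ends a₂ b)))) := by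
  have h21 : a₂ ≠ a₁ := Ne.symm h12
  have ho : o ≠ a₁ := Ne.symm h1o
  have c₂o : Free f (connEvent ends a₂ o) := free_connEvent hf hleaf h1o h21 ho
  have c₂b : Free f (connEvent ends a₂ b) := free_connEvent hf hleaf h1o h21 hb
  unfold Gc DEF EQbo EQb3 EQb3o EQo EQ3 EQ3o PDb PDbo Do gap
  rw [RootLeafA3.prob_Q p hf hleaf h1o h12,
    RootLeafA3.prob_Q_inter_LL p hf hleaf h1o h12 ho hb,
    RootLeafA3.prob_Q_inter p hf hleaf h1o h12 (c₂o.inter c₂b),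
    RootLeafA3.prob_Q_inter_R p hf hleaf h1o h12 hb c₂o,
    RootLeafA3.prob_Q_inter_L p hf hleaf h1o h12 ho c₂b,
    RootLeafA3.prob_Q_inter_L₀ p hf hleaf h1o h12 ho, RootLeafA3.prob_Q_inter p hf hleaf h1o h12 c₂o,
    prob_T'_inter_L₀ p hf hleaf h1o h12 h13 hb, prob_T_inter p hf hleaf h1o h12 h13 c₂b,
    prob_T_inter_L₀ p hf hleaf h1o h12 h13 hb, prob_T'_inter p hf hleaf h1o h12 h13 c₂b,
    prob_T'_inter_LL p hf hleaf h1o h12 h13 ho hb, prob_T'_inter_R p hf hleaf h1o h12 h13 hb c₂o,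
    prob_T_inter_L p hf hleaf h1o h12 h13 ho c₂b, prob_T_inter p hf hleaf h1o h12 h13 (c₂o.inter c₂b),
    prob_T_inter_LL p hf hleaf h1o h12 h13 ho hb, prob_T_inter_R p hf hleaf h1o h12 h13 hb c₂o,
    prob_T'_inter_L p hf hleaf h1o h12 h13 ho c₂b,
    prob_T'_inter p hf hleaf h1o h12 h13 (c₂o.inter c₂b),
    prob_T' p hf hleaf h1o h12 h13, prob_T p hf hleaf h1o h12 h13,
    prob_T'_inter_L₀ p hf hleaf h1o h12 h13 ho, prob_T'_inter p hf hleaf h1o h12 h13 c₂o,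
    prob_T_inter_L₀ p hf hleaf h1o h12 h13 ho, prob_T_inter p hf hleaf h1o h12 h13 c₂o,
    prob_PD_inter_L₀ p hf hleaf h1o h12 h13 hb, prob_PD_inter p hf hleaf h1o h12 h13 c₂b,
    prob_PD_inter_LL p hf hleaf h1o h12 h13 ho hb, prob_PD_inter_R p hf hleaf h1o h12 h13 hb c₂o,
    prob_PD_inter_L p hf hleaf h1o h12 h13 ho c₂b,
    prob_PD_inter p hf hleaf h1o h12 h13 (c₂o.inter c₂b),
    prob_PD_inter_L₀ p hf hleaf h1o h12 h13 ho, prob_PD_inter p hf hleaf h1o h12 h13 c₂o,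
    prob_PD p hf hleaf h1o h12 h13, RootLeafA3.prob_conn_leaf p hf hleaf h1o hb]
  simp only [connEvent_self ends o, Set.univ_inter, Set.inter_univ]
  simp only [cells_Qo p ends o a₂ a₃ b, cells_Qo_ob p ends o a₂ a₃ b,
    cells_Qo_a2o_a2b p ends o a₂ a₃ b, cells_Qo_a2o_ob p ends o a₂ a₃ b,
    cells_Qo_a2b p ends o a₂ a₃ b, cells_Qo_a2o p ends o a₂ a₃ b, cells_PD1 p ends o a₂ a₃ b,
    cells_PD1_a2o p ends o a₂ a₃ b, cells_PD1_ob p ends o a₂ a₃ b, cells_PD1_a2b p ends o a₂ a₃ b,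
    cells_PD1_a2o_ob p ends o a₂ a₃ b, cells_PD1_a2o_a2b p ends o a₂ a₃ b,
    cells_T1 p ends o a₂ a₃ b, cells_T1_a2o p ends o a₂ a₃ b, cells_T1_ob p ends o a₂ a₃ b,
    cells_T1_a2b p ends o a₂ a₃ b, cells_T1_a2o_ob p ends o a₂ a₃ b,
    cells_T1_a2o_a2b p ends o a₂ a₃ b, cells_Tp1 p ends o a₂ a₃ b, cells_Tp1_a2o p ends o a₂ a₃ b,
    cells_Tp1_ob p ends o a₂ a₃ b, cells_Tp1_a2b p ends o a₂ a₃ b,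
    cells_Tp1_a2o_ob p ends o a₂ a₃ b, cells_Tp1_a2o_a2b p ends o a₂ a₃ b,
    cells_ob p ends o a₂ a₃ b, cells_a2b p ends o a₂ a₃ b, cells_univ p ends o a₂ a₃ b,
    cells_N3 p ends o a₂ a₃ b, cells_N3_a2o p ends o a₂ a₃ b, cells_N3_a2b p ends o a₂ a₃ b,
    cells_N3_a2o_a2b p ends o a₂ a₃ b, cells_a2o_a2b p ends o a₂ a₃ b,
    cells_H3_a2b p ends o a₂ a₃ b, cells_H3_a2o_a2b p ends o a₂ a₃ b, cells_a2o p ends o a₂ a₃ b,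
    cells_H3 p ends o a₂ a₃ b, cells_H3_a2o p ends o a₂ a₃ b, cells_oa2 p ends o a₂ a₃ b,
    cells_oa2_a2b p ends o a₂ a₃ b, cells_A p ends o a₂ a₃ b, cells_A_a2b p ends o a₂ a₃ b,
    cells_Eev p ends o a₂ a₃ b, cells_Eev_a2b p ends o a₂ a₃ b, cells_e0 p ends o a₂ a₃ b]
  ring

end Main

/-! ## The sign facts and the theorem -/

section Theorem

variable [Fintype V] [DecidableEq V] (p : E → R) (ends : E → Sym2 V)

omit [Fintype E] [DecidableEq E] [Fintype V] [DecidableEq V] [LinearOrder R] [IsStrictOrderedRing R] in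
/-- `{a₃ ↔ o, a₃ ↮ a₂} = T′(o)`. -/
lemma setOf_a3o_not_a3a2 (o a₂ a₃ : V) :
    {ω : Config E | Conn ends ω a₃ o ∧ ¬ Conn ends ω a₃ a₂} = TEvent ends a₂ o a₃ := by
  ext ω
  simp only [Set.mem_setOf_eq, TEvent, Set.mem_inter_iff, Set.mem_compl_iff, mem_connEvent]
  constructor
  · rintro ⟨h1, h2⟩
    exact ⟨fun h => h2 (conn_trans h1 h), conn_symm h1⟩
  · rintro ⟨h1, h2⟩
    exact ⟨conn_symm h2, fun h => h1 (conn_trans h2 h)⟩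

omit [Fintype E] [DecidableEq E] [Fintype V] [DecidableEq V] [LinearOrder R] [IsStrictOrderedRing R] in
/-- `{a₃ ↔ a₂, a₃ ↮ o} = T(o)`. -/
lemma setOf_a3a2_not_a3o (o a₂ a₃ : V) :
    {ω : Config E | Conn ends ω a₃ a₂ ∧ ¬ Conn ends ω a₃ o} = TEvent ends o a₂ a₃ := by
  ext ω
  simp only [Set.mem_setOf_eq, TEvent, Set.mem_inter_iff, Set.mem_compl_iff, mem_connEvent]
  constructor
  · rintro ⟨h1, h2⟩
    exact ⟨fun h => h2 (conn_trans h1 h), conn_symm h1⟩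
  · rintro ⟨h1, h2⟩
    exact ⟨conn_symm h2, fun h => h1 (conn_trans h2 h)⟩

omit [Fintype E] [DecidableEq E] [Fintype V] [DecidableEq V] [LinearOrder R] [IsStrictOrderedRing R] in
/-- `{a₃ ↮ o, a₃ ↮ a₂, o ↮ a₂} = PD(o)`. -/
lemma setOf_all_sep (o a₂ a₃ : V) :
    {ω : Config E | ¬ Conn ends ω a₃ o ∧ ¬ Conn ends ω a₃ a₂ ∧ ¬ Conn ends ω o a₂} =
      PDEvent ends o a₂ a₃ := by
  ext ω
  simp only [Set.mem_setOf_eq, PDEvent, Dtilde, inU, Set.mem_inter_iff, Set.mem_compl_iff,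
    Set.mem_union, mem_connEvent, not_or]
  tauto

omit [Fintype E] [DecidableEq E] [Fintype V] [DecidableEq V] [LinearOrder R] [IsStrictOrderedRing R] in
/-- `{a₃ ↔ o, a₃ ↔ a₂} ⊆ {o ↔ a₂}`. -/
lemma setOf_a3o_a3a2_subset (o a₂ a₃ : V) :
    {ω : Config E | Conn ends ω a₃ o ∧ Conn ends ω a₃ a₂} ⊆ connEvent ends o a₂ := by
  rintro ω ⟨h1, h2⟩
  exact conn_trans (conn_symm h1) h2

omit [Fintype V] [DecidableEq V] in
/-- **(D_D) in the `(o, a₂)`-world**: `x·y ≤ d·P(o ↔ a₂)` (`PatternAD.prob_mul_prob_le_three`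
with `u = a₃`, `v = o`, `w = a₂`, then `P(o ↔ a₂, a₃ ↔ a₂) ≤ P(o ↔ a₂)`). -/
lemma xy_le_d_PoH (hp : IsProbVec p) (o a₂ a₃ : V) :
    prob p (TEvent ends a₂ o a₃) * prob p (TEvent ends o a₂ a₃) ≤
      prob p (PDEvent ends o a₂ a₃) * prob p (connEvent ends o a₂) := by
  have h := PatternAD.prob_mul_prob_le_three hp ends a₃ o a₂
  rw [setOf_a3o_not_a3a2, setOf_a3a2_not_a3o, setOf_all_sep] at h
  have h2 := prob_mono hp (setOf_a3o_a3a2_subset ends o a₂ a₃)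
  have hd := prob_nonneg hp (PDEvent ends o a₂ a₃)
  calc prob p (TEvent ends a₂ o a₃) * prob p (TEvent ends o a₂ a₃)
      ≤ prob p {ω | Conn ends ω a₃ o ∧ Conn ends ω a₃ a₂} * prob p (PDEvent ends o a₂ a₃) := h
    _ ≤ prob p (connEvent ends o a₂) * prob p (PDEvent ends o a₂ a₃) :=
        mul_le_mul_of_nonneg_right h2 hd
    _ = prob p (PDEvent ends o a₂ a₃) * prob p (connEvent ends o a₂) := mul_comm _ _

/-- **(HCOV) when the root `a₁` is a leaf at `o`**, for every weight of the leaf edge and every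
`G − a₁` (p4 g2, S3 (G4-o)): the identity `Gc_root_leaf_o` and the signs — Harris for the
increasing events `{b ↔ a₂}`, `{o ↔ a₂}`, `{o ↔ a₂} ∪ {o ↔ a₃}` and the decreasing
`{o ↮ a₂, o ↮ a₃}`, and `(D_D)` (`PatternAD`). -/
theorem HCov_root_leaf_o (hp : IsProbVec p) {f : E} {a₁ o : V} (hf : ends f = s(a₁, o))
    (hleaf : ∀ e, a₁ ∈ ends e → e = f) (h1o : a₁ ≠ o) {a₂ a₃ b : V} (h12 : a₁ ≠ a₂)
    (h13 : a₁ ≠ a₃) (hb : b ≠ a₁) : HCov p ends o a₁ a₂ a₃ b := by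
  unfold HCov
  have hid := Gc_root_leaf_o p ends hf hleaf h1o h12 h13 hb
  simp only [prob_univ, one_mul] at hid
  rw [hid]
  -- the sign facts
  have hq0 := hp.nonneg f
  have hq1 := sub_nonneg.2 (hp.le_one f)
  have hx := prob_nonneg hp (TEvent ends a₂ o a₃)
  have hd := prob_nonneg hp (PDEvent ends o a₂ a₃)
  have hy := prob_nonneg hp (TEvent ends o a₂ a₃)
  have hZ := prob_nonneg hp (avoidAll ends a₂ {o})
  have hYL := prob_nonneg hp (avoidAll ends a₂ {o} ∩ connEvent ends o b)
  have hMLH := prob_nonneg hp (TEvent ends o a₂ a₃ ∩ connEvent ends o b)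
  have he0 := prob_nonneg hp (connEvent ends o a₂ ∩ (connEvent ends a₂ a₃)ᶜ)
  have hdd := xy_le_d_PoH p ends hp o a₂ a₃
  -- Harris: `{o ↔ a₂}` and `{b ↔ a₂}`
  have hH1 := prob_mul_prob_le_prob_inter hp (isUpperSet_connEvent ends o a₂)
    (isUpperSet_connEvent ends a₂ b)
  -- Harris: `{o ↔ a₂} ∪ {o ↔ a₃}` and `{b ↔ a₂}`
  have hH2 := prob_mul_prob_le_prob_inter hp
    ((isUpperSet_connEvent ends o a₂).union (isUpperSet_connEvent ends o a₃))
    (isUpperSet_connEvent ends a₂ b)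
  -- Harris, mixed: `E = {o ↮ a₂} ∩ {o ↮ a₃}` decreasing against `{b ↔ a₂}`
  have hE : IsLowerSet (avoidAll ends a₂ {o} ∩ (connEvent ends o a₃)ᶜ) := by
    rw [avoidAll_eq_compl]
    exact (isUpperSet_connEvent ends o a₂).compl.inter (isUpperSet_connEvent ends o a₃).compl
  have hH3 := prob_inter_le_prob_mul_prob_of_isLowerSet hp hE (isUpperSet_connEvent ends a₂ b)
  have hB1 : 0 ≤ prob p (TEvent ends o a₂ a₃ ∩ connEvent ends o b) +
      prob p (avoidAll ends a₂ {o} ∩ (connEvent ends o a₃)ᶜ) * prob p (connEvent ends a₂ b) -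
      prob p (avoidAll ends a₂ {o} ∩ (connEvent ends o a₃)ᶜ ∩ connEvent ends a₂ b) := by
    linarith
  have hB2 : 0 ≤ prob p (avoidAll ends a₂ {o} ∩ connEvent ends o b) +
      prob p (connEvent ends o a₂ ∩ connEvent ends a₂ b) -
      prob p (connEvent ends o a₂) * prob p (connEvent ends a₂ b) := by
    linarith
  have hS1 : 0 ≤ prob p ((connEvent ends o a₂ ∪ connEvent ends o a₃) ∩ connEvent ends a₂ b) -
      prob p (connEvent ends o a₂ ∪ connEvent ends o a₃) * prob p (connEvent ends a₂ b) := by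
    linarith
  have hS2 : 0 ≤ prob p (connEvent ends o a₂ ∩ connEvent ends a₂ b) -
      prob p (connEvent ends o a₂) * prob p (connEvent ends a₂ b) := by
    linarith
  have hDD : 0 ≤ prob p (PDEvent ends o a₂ a₃) * prob p (connEvent ends o a₂) -
      prob p (TEvent ends a₂ o a₃) * prob p (TEvent ends o a₂ a₃) := by
    linarith
  have hcoef : 0 ≤ prob p (PDEvent ends o a₂ a₃) * prob p (avoidAll ends a₂ {o}) +
      prob p (TEvent ends a₂ o a₃) * prob p (TEvent ends o a₂ a₃) +
      prob p (TEvent ends a₂ o a₃) * prob p (TEvent ends a₂ o a₃) +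
      prob p (PDEvent ends o a₂ a₃) * prob p (TEvent ends a₂ o a₃) := by positivity
  have hU : 0 ≤ 2 * (prob p (TEvent ends a₂ o a₃) + prob p (PDEvent ends o a₂ a₃)) *
      (prob p (TEvent ends o a₂ a₃ ∩ connEvent ends o b) +
        prob p (avoidAll ends a₂ {o} ∩ (connEvent ends o a₃)ᶜ) * prob p (connEvent ends a₂ b) -
        prob p (avoidAll ends a₂ {o} ∩ (connEvent ends o a₃)ᶜ ∩ connEvent ends a₂ b)) +
      2 * prob p (connEvent ends o a₂ ∩ (connEvent ends a₂ a₃)ᶜ) *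
      (prob p (avoidAll ends a₂ {o} ∩ connEvent ends o b) +
        prob p (connEvent ends o a₂ ∩ connEvent ends a₂ b) -
        prob p (connEvent ends o a₂) * prob p (connEvent ends a₂ b)) :=
    add_nonneg (mul_nonneg (mul_nonneg (by norm_num) (add_nonneg hx hd)) hB1)
      (mul_nonneg (mul_nonneg (by norm_num) he0) hB2)
  have hC : 0 ≤ prob p (avoidAll ends a₂ {o} ∩ connEvent ends o b) *
      (prob p (PDEvent ends o a₂ a₃) * prob p (connEvent ends o a₂) -
        prob p (TEvent ends a₂ o a₃) * prob p (TEvent ends o a₂ a₃)) +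
      (prob p (TEvent ends a₂ o a₃) + prob p (PDEvent ends o a₂ a₃)) *
        prob p (avoidAll ends a₂ {o}) * prob p (TEvent ends o a₂ a₃ ∩ connEvent ends o b) +
      (prob p (PDEvent ends o a₂ a₃) * prob p (avoidAll ends a₂ {o}) +
        prob p (TEvent ends a₂ o a₃) * prob p (TEvent ends o a₂ a₃) +
        prob p (TEvent ends a₂ o a₃) * prob p (TEvent ends a₂ o a₃) +
        prob p (PDEvent ends o a₂ a₃) * prob p (TEvent ends a₂ o a₃)) *
        (prob p ((connEvent ends o a₂ ∪ connEvent ends o a₃) ∩ connEvent ends a₂ b) -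
          prob p (connEvent ends o a₂ ∪ connEvent ends o a₃) * prob p (connEvent ends a₂ b)) +
      (prob p (PDEvent ends o a₂ a₃) * prob p (connEvent ends o a₂) -
        prob p (TEvent ends a₂ o a₃) * prob p (TEvent ends o a₂ a₃)) *
        (prob p (connEvent ends o a₂ ∩ connEvent ends a₂ b) -
          prob p (connEvent ends o a₂) * prob p (connEvent ends a₂ b)) :=
    add_nonneg (add_nonneg (add_nonneg (mul_nonneg hYL hDD)
      (mul_nonneg (mul_nonneg (add_nonneg hx hd) hZ) hMLH)) (mul_nonneg hcoef hS1))
      (mul_nonneg hDD hS2)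
  have hq2 : 0 ≤ p f * (1 - p f) ^ 2 := mul_nonneg hq0 (pow_nonneg hq1 2)
  have hq3 : 0 ≤ p f ^ 2 * (1 - p f) := mul_nonneg (pow_nonneg hq0 2) hq1
  exact add_nonneg (mul_nonneg hq2 hU) (mul_nonneg hq3 (mul_nonneg (by norm_num) hC))

/-- **(HCOV) when the root `a₂` is a leaf at `o`** (by the root symmetry `Gc_swap`). -/
theorem HCov_root_leaf_o' (hp : IsProbVec p) {f : E} {a₂ o : V} (hf : ends f = s(a₂, o))
    (hleaf : ∀ e, a₂ ∈ ends e → e = f) (h2o : a₂ ≠ o) {a₁ a₃ b : V} (h21 : a₂ ≠ a₁)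
    (h23 : a₂ ≠ a₃) (hb : b ≠ a₂) : HCov p ends o a₁ a₂ a₃ b :=
  (HCov_swap p ends o a₁ a₂ a₃ b).1 (HCov_root_leaf_o p ends hp hf hleaf h2o h21 h23 hb)

end Theorem

end RootLeafO

end Summit.Ventures.PercRepro2
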